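import Mathlib
import Summits.ResolutionOfSingularities.ResolutionOfSingularities.Theorems.WeightedInvariantLocalWeightedDropWildMonicFlagDefs
import Summits.ResolutionOfSingularities.ResolutionOfSingularities.Theorems.WeightedInvariantLocalWeightedDropWildMonicShift

/-!
# `WeightedInvariant.LocalWeightedDrop`, stub S3ρ `stub_wildMonicSurfaceReductionWon`: the MONIC POLYHEDRON DESCENT — labels `y^d + Σ A_j y^j`,
# vertex polynomials, solvable vertices, well-preparedness, preparing re-centrings, and the successor labels of the strategy Σ**_d (definitions)

Crux item stmt-ResolutionOfSingularities-8899 `LocalWeightedDrop` (route `ResolutionOfSingularities/WeightedInvariant`), registered skeleton v30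
(09f812eb3be8b7d8), stub S3ρ `stub_wildMonicSurfaceReductionWon` (every monic surface form `y^d + Σ_{j<d} A_j(x₁,x₂) y^j` of degree `d` with `p ∣ d`,
`d > 2`, `ord A_j > d − j`).  [OURS · L1 W4.3, chain w43, lead prover (gen 3).  Objects the engine line posits for a SECOND KEY to S3ρ («monic polyhedron
descent», memo `L/res-L1-w43-lead-1/g3/S3RHO-CJS-MEMO.md`); the MODEL is Cossart–Jannsen–Saito LNM 2270 Ch. 8/11/13 for `J = (y^d + Σ A_j y^j)`,
`e = 2`, `k = k̄` — the third instance after the degree-2 key N4″ (`…MonicDescent*`, p500522) and the pure-power key (`…PureDescent*`, S3πM p510457);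
nothing here is a statement of any manuscript.]

A LABEL is a tuple `A : Fin d → k[[u₁,u₂]]`; its SCALED NEWTON SET is stub-7's `WildMonic.newtonSet A` (the points `(d!/(d−j))·e` over the exponents
`e` of `A_j`; `= d! ·` the generating points of Hironaka's polygon `Δ(f; u; y)`), on which the chart maps are `MonicDescent.psi d!` / `phiE d!` / the
shifts by `(d!,0)`, `(0,d!)` uniformly in the slot, and the invariants are `MonicDescent.deltaL/alphaL/betaL/gammaL/epsL/zetaL`.  The ONE ingredient that
the pure case (`A_j = 0` for `j ≥ 1`, where cleaning is canonical) did not need: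
* `vertexCoeff d A P j` — the coefficient of `A_j` sitting at the scaled point `P` (zero if `P` is not a slot-`j` point); `Solvable d A P` — `P` is an
  INTEGRAL point (`d! ∣ P`, i.e. the true vertex `P/d!` lies in `ℤ²`) and the VERTEX POLYNOMIAL `Y^d + Σ_j vertexCoeff_j Y^j` is a `d`-th power `(Y + λ)^d`
  (CJS Def. 8.13); `WellPrepared d A` — no vertex of the Newton set is solvable (CJS Def. 8.15);
* `IsPrepRecentring d A ψ` — `ψ(0) = 0`, the re-centred tuple `WildMonic.shift d A ψ` (Taylor, `y ↦ y + ψ`) is a well-prepared position, and every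
  NON-solvable vertex of the old Newton set persists with its vertex coefficients (the shape of the degree-2 `MonicDescent.IsPrepRecentring`; its
  existence for every position = Hironaka's vertex preparation, piece (ρ-P) of the memo); `prepPsi`, `prep` — an `ε`-choice;
* `IsPosT`, `IsPermissibleOneT/TwoT`, the slotwise transports `blowOneT/blowTwoT/divOneT/divTwoT/shearT`, `HasGraphCurveT`, `graphShearT`, and the
  SUCCESSOR LABELS `succT d A` of Σ**_d (= `PureDescent.succ` with `prep` for `clean`).
Only definitions and unfoldings.
-/

set_option linter.dupNamespace false -- mandated namespace of this single-conjunct summit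

noncomputable section

namespace Summit.ResolutionOfSingularities.ResolutionOfSingularities.Theorems

namespace PolyDescent

open MvPowerSeries MonicDescent WildMonic

variable {k : Type} [Field k]

/-! ## Positions, permissibility, slotwise transports -/

/-- A POSITION: `ord A_j > d − j` for every slot (tangent cone `y^d`). -/
def IsPosT (d : ℕ) (A : Fin d → MvPowerSeries (Fin 2) k) : Prop := ∀ j : Fin d, ((d - (j : ℕ) : ℕ) : ℕ∞) < (A j).order

/-- `V(y,u₁)` is PERMISSIBLE: `u₁^{d−j} ∣ A_j` for every slot. -/
def IsPermissibleOneT (d : ℕ) (A : Fin d → MvPowerSeries (Fin 2) k) : Prop :=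
  ∀ (j : Fin d) (e : Fin 2 →₀ ℕ), coeff e (A j) ≠ 0 → d - (j : ℕ) ≤ e 0

/-- `V(y,u₂)` is PERMISSIBLE: `u₂^{d−j} ∣ A_j` for every slot. -/
def IsPermissibleTwoT (d : ℕ) (A : Fin d → MvPowerSeries (Fin 2) k) : Prop :=
  ∀ (j : Fin d) (e : Fin 2 →₀ ℕ), coeff e (A j) ≠ 0 → d - (j : ℕ) ≤ e 1

/-- Point blow-up, origin of the `u₁`-chart, slotwise: `A_j ↦ A_j(u₁, u₁u₂)/u₁^{d−j}`. -/
def blowOneT (d : ℕ) (A : Fin d → MvPowerSeries (Fin 2) k) : Fin d → MvPowerSeries (Fin 2) k := fun j => blowOne (d - (j : ℕ)) (A j)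

/-- Point blow-up, origin of the `u₂`-chart, slotwise. -/
def blowTwoT (d : ℕ) (A : Fin d → MvPowerSeries (Fin 2) k) : Fin d → MvPowerSeries (Fin 2) k := fun j => blowTwo (d - (j : ℕ)) (A j)

/-- Blow-up of `V(y,u₁)`, slotwise: `A_j ↦ A_j/u₁^{d−j}`. -/
def divOneT (d : ℕ) (A : Fin d → MvPowerSeries (Fin 2) k) : Fin d → MvPowerSeries (Fin 2) k := fun j => divOne (d - (j : ℕ)) (A j)

/-- Blow-up of `V(y,u₂)`, slotwise. -/
def divTwoT (d : ℕ) (A : Fin d → MvPowerSeries (Fin 2) k) : Fin d → MvPowerSeries (Fin 2) k := fun j => divTwo (d - (j : ℕ)) (A j)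

/-- The `u₂`-shear `A_j ↦ A_j(u₁, u₂ + u₁h)`, slotwise. -/
def shearT {d : ℕ} (h : MvPowerSeries (Fin 2) k) (A : Fin d → MvPowerSeries (Fin 2) k) : Fin d → MvPowerSeries (Fin 2) k :=
  fun j => shear h (A j)

/-! ## Vertex coefficients, solvable vertices, well-preparedness (CJS Def. 8.13 / 8.15 for `J = (y^d + Σ A_j y^j)`) -/

/-- The COEFFICIENT OF SLOT `j` AT THE SCALED POINT `P`: the coefficient of `A_j` at the exponent `P/(d!/(d−j))` when that exponent is integral,
`0` otherwise. -/
def vertexCoeff (d : ℕ) (A : Fin d → MvPowerSeries (Fin 2) k) (P : Fin 2 →₀ ℕ) (j : Fin d) : k :=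
  if ∀ i, slotWeight d j ∣ P i then
    coeff (Finsupp.single 0 (P 0 / slotWeight d j) + Finsupp.single 1 (P 1 / slotWeight d j)) (A j)
  else 0

/-- An INTEGRAL scaled point: `d! ∣ P` (the true point `P/d!` lies in `ℤ²`). -/
def IsIntegral (d : ℕ) (P : Fin 2 →₀ ℕ) : Prop := ∀ i, d.factorial ∣ P i

/-- `P` IS SOLVABLE for `A`: `P` is integral and the vertex polynomial `Y^d + Σ_j vertexCoeff_j Y^j` equals `(Y + λ)^d` for some `λ` — so that the
re-centring `y ↦ y − λ u^{P/d!}` deletes the point (CJS Def. 8.13). -/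
def Solvable (d : ℕ) (A : Fin d → MvPowerSeries (Fin 2) k) (P : Fin 2 →₀ ℕ) : Prop :=
  IsIntegral d P ∧ ∃ la : k, ∀ j : Fin d, vertexCoeff d A P j = ((d.choose (j : ℕ) : ℕ) : k) * la ^ (d - (j : ℕ))

/-- A WELL-PREPARED label: no vertex of its scaled Newton set is solvable (CJS Def. 8.15). -/
def WellPrepared (d : ℕ) (A : Fin d → MvPowerSeries (Fin 2) k) : Prop :=
  ∀ P, IsVertex (newtonSet A) P → ¬ Solvable d A P

/-! ## Preparing re-centrings, the strategy Σ**_d -/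

/-- `ψ` is a WELL-PREPARING RE-CENTRING of `A`: `ψ(0) = 0`, the re-centred tuple is a well-prepared position, and every NON-SOLVABLE vertex of the old
Newton set is still a vertex with the same vertex coefficients (CJS Lemma 8.x / Thm 8.24 shape: preparation only dissolves solvable vertices). -/
def IsPrepRecentring (d : ℕ) (A : Fin d → MvPowerSeries (Fin 2) k) (ψ : MvPowerSeries (Fin 2) k) : Prop :=
  constantCoeff ψ = 0 ∧ IsPosT d (shift d A ψ) ∧ WellPrepared d (shift d A ψ) ∧
    ∀ P, IsVertex (newtonSet A) P → ¬ Solvable d A P →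
      IsVertex (newtonSet (shift d A ψ)) P ∧ ∀ j : Fin d, vertexCoeff d (shift d A ψ) P j = vertexCoeff d A P j

/-- An `ε`-chosen well-preparing re-centring (junk if none exists; existence for every position is piece (ρ-P)). -/
def prepPsi (d : ℕ) (A : Fin d → MvPowerSeries (Fin 2) k) : MvPowerSeries (Fin 2) k :=
  Classical.epsilon (IsPrepRecentring d A)

/-- The PREPARED label `shift A prepPsi`. -/
def prep (d : ℕ) (A : Fin d → MvPowerSeries (Fin 2) k) : Fin d → MvPowerSeries (Fin 2) k := shift d A (prepPsi d A)

/-- Some regular near curve is a GRAPH OVER `u₁`: for some `h = h(u₁)` and some re-centring `ψ`, `V(y, ũ₂)` (`ũ₂ = u₂ + u₁h`) is permissible for the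
sheared re-centred label. -/
def HasGraphCurveT (d : ℕ) (A : Fin d → MvPowerSeries (Fin 2) k) : Prop :=
  ∃ h ψ : MvPowerSeries (Fin 2) k, (∀ e : Fin 2 →₀ ℕ, e 1 ≠ 0 → coeff e h = 0) ∧ constantCoeff ψ = 0 ∧
    IsPermissibleTwoT d (shift d (shearT h A) ψ)

/-- An `ε`-chosen graph-curve shear `h(u₁)`. -/
def graphShearT (d : ℕ) (A : Fin d → MvPowerSeries (Fin 2) k) : MvPowerSeries (Fin 2) k :=
  Classical.epsilon fun h : MvPowerSeries (Fin 2) k => ∃ ψ : MvPowerSeries (Fin 2) k,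
    (∀ e : Fin 2 →₀ ℕ, e 1 ≠ 0 → coeff e h = 0) ∧ constantCoeff ψ = 0 ∧ IsPermissibleTwoT d (shift d (shearT h A) ψ)

open Classical in
/-- THE SUCCESSOR LABELS OF THE STRATEGY Σ**_d at a (well-prepared) label `A` (the degree-2 `MonicDescent.succLabels` / pure `PureDescent.succ` verbatim with
`prep` as the preparation): (a′) `V(y,u₁)` permissible ↦ `{A/u₁^{d−·}}`; else `V(y,u₂)` ↦ `{A/u₂^{d−·}}`; (a″) else a graph curve ↦
`{prep(shear_h A)/ũ₂^{d−·}}`; (b) else the point blow-up: `u₁`-chart, `u₂`-chart, and for every `λ ≠ 0` the `u₁`-chart of `prep (shear_λ A)`. -/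
def succT (d : ℕ) (A : Fin d → MvPowerSeries (Fin 2) k) : Set (Fin d → MvPowerSeries (Fin 2) k) :=
  if IsPermissibleOneT d A then {divOneT d A}
  else if IsPermissibleTwoT d A then {divTwoT d A}
  else if HasGraphCurveT d A then {divTwoT d (prep d (shearT (graphShearT d A) A))}
  else {blowOneT d A, blowTwoT d A} ∪ {B | ∃ c : k, c ≠ 0 ∧ B = blowOneT d (prep d (shearT (C c) A))}

/-! ## Unfoldings -/

/-- Unfolding of `vertexCoeff` on a slot-`j` point. -/
theorem vertexCoeff_of_dvd {d : ℕ} (A : Fin d → MvPowerSeries (Fin 2) k) {P : Fin 2 →₀ ℕ} {j : Fin d} (h : ∀ i, slotWeight d j ∣ P i) :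
    vertexCoeff d A P j = coeff (Finsupp.single 0 (P 0 / slotWeight d j) + Finsupp.single 1 (P 1 / slotWeight d j)) (A j) := by
  unfold vertexCoeff; rw [if_pos h]

/-- Unfolding of `vertexCoeff` off the slot-`j` lattice. -/
theorem vertexCoeff_of_not_dvd {d : ℕ} (A : Fin d → MvPowerSeries (Fin 2) k) {P : Fin 2 →₀ ℕ} {j : Fin d} (h : ¬ ∀ i, slotWeight d j ∣ P i) :
    vertexCoeff d A P j = 0 := by
  unfold vertexCoeff; rw [if_neg h]

/-- The vertex coefficient at a scaled exponent `(d!/(d−j))·e` of slot `j` is the coefficient of `A_j` at `e`. -/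
theorem vertexCoeff_smul {d : ℕ} (A : Fin d → MvPowerSeries (Fin 2) k) (j : Fin d) (e : Fin 2 →₀ ℕ) :
    vertexCoeff d A (slotWeight d j • e) j = coeff e (A j) := by
  have hw := slotWeight_pos j
  rw [vertexCoeff_of_dvd A (fun i => by rw [Finsupp.smul_apply, smul_eq_mul]; exact dvd_mul_right _ _)]
  have hidx : (Finsupp.single 0 ((slotWeight d j • e) 0 / slotWeight d j) + Finsupp.single 1 ((slotWeight d j • e) 1 / slotWeight d j) :
      Fin 2 →₀ ℕ) = e :=
    Literature.RingTheory.TwoVariableSeries.finsupp_fin2_ext (by simp [Nat.mul_div_cancel_left _ hw]) (by simp [Nat.mul_div_cancel_left _ hw])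
  rw [hidx]

/-- A point of the Newton set carries a non-zero vertex coefficient in its slot. -/
theorem exists_vertexCoeff_ne_zero_of_mem {d : ℕ} {A : Fin d → MvPowerSeries (Fin 2) k} {P : Fin 2 →₀ ℕ} (hP : P ∈ newtonSet A) :
    ∃ j : Fin d, vertexCoeff d A P j ≠ 0 := by
  obtain ⟨j, e, he, rfl⟩ := hP
  exact ⟨j, by rw [vertexCoeff_smul]; exact he⟩

/-- Conversely a non-zero vertex coefficient exhibits a point of the Newton set. -/
theorem mem_newtonSet_of_vertexCoeff_ne_zero {d : ℕ} {A : Fin d → MvPowerSeries (Fin 2) k} {P : Fin 2 →₀ ℕ} {j : Fin d}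
    (h : vertexCoeff d A P j ≠ 0) : P ∈ newtonSet A := by
  by_cases hdvd : ∀ i, slotWeight d j ∣ P i
  · rw [vertexCoeff_of_dvd A hdvd] at h
    refine ⟨j, _, h, Literature.RingTheory.TwoVariableSeries.finsupp_fin2_ext ?_ ?_⟩
    · simp [Nat.mul_div_cancel' (hdvd 0)]
    · simp [Nat.mul_div_cancel' (hdvd 1)]
  · exact absurd (vertexCoeff_of_not_dvd A hdvd) h

/-- The prepared label of a preparable position is prepared by a well-preparing re-centring. -/
theorem isPrepRecentring_prepPsi {d : ℕ} {A : Fin d → MvPowerSeries (Fin 2) k} (h : ∃ ψ, IsPrepRecentring d A ψ) :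
    IsPrepRecentring d A (prepPsi d A) :=
  Classical.epsilon_spec h

/-- The `ε`-chosen graph shear has the defining property when a graph curve exists. -/
theorem graphShearT_spec {d : ℕ} {A : Fin d → MvPowerSeries (Fin 2) k} (h : HasGraphCurveT d A) :
    ∃ ψ : MvPowerSeries (Fin 2) k, (∀ e : Fin 2 →₀ ℕ, e 1 ≠ 0 → coeff e (graphShearT d A) = 0) ∧ constantCoeff ψ = 0 ∧
      IsPermissibleTwoT d (shift d (shearT (graphShearT d A) A) ψ) := by
  obtain ⟨h', ψ, hh', hψ, hperm⟩ := h
  exact Classical.epsilon_spec (p := fun h : MvPowerSeries (Fin 2) k => ∃ ψ : MvPowerSeries (Fin 2) k,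
    (∀ e : Fin 2 →₀ ℕ, e 1 ≠ 0 → coeff e h = 0) ∧ constantCoeff ψ = 0 ∧ IsPermissibleTwoT d (shift d (shearT h A) ψ)) ⟨h', ψ, hh', hψ, hperm⟩

/-- Unfolding of `succT`, case (a′) `V(y,u₁)`. -/
theorem succT_of_isPermissibleOneT {d : ℕ} {A : Fin d → MvPowerSeries (Fin 2) k} (h : IsPermissibleOneT d A) : succT d A = {divOneT d A} := by
  unfold succT; rw [if_pos h]

/-- Unfolding of `succT`, case (a′) `V(y,u₂)`. -/
theorem succT_of_isPermissibleTwoT {d : ℕ} {A : Fin d → MvPowerSeries (Fin 2) k} (h1 : ¬ IsPermissibleOneT d A) (h2 : IsPermissibleTwoT d A) :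
    succT d A = {divTwoT d A} := by
  unfold succT; rw [if_neg h1, if_pos h2]

/-- Unfolding of `succT`, case (a″). -/
theorem succT_of_hasGraphCurveT {d : ℕ} {A : Fin d → MvPowerSeries (Fin 2) k} (h1 : ¬ IsPermissibleOneT d A) (h2 : ¬ IsPermissibleTwoT d A)
    (h3 : HasGraphCurveT d A) : succT d A = {divTwoT d (prep d (shearT (graphShearT d A) A))} := by
  unfold succT; rw [if_neg h1, if_neg h2, if_pos h3]

/-- Unfolding of `succT`, case (b). -/
theorem succT_of_point {d : ℕ} {A : Fin d → MvPowerSeries (Fin 2) k} (h1 : ¬ IsPermissibleOneT d A) (h2 : ¬ IsPermissibleTwoT d A)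
    (h3 : ¬ HasGraphCurveT d A) :
    succT d A = {blowOneT d A, blowTwoT d A} ∪ {B | ∃ c : k, c ≠ 0 ∧ B = blowOneT d (prep d (shearT (C c) A))} := by
  unfold succT; rw [if_neg h1, if_neg h2, if_neg h3]

/-- For a position every point of the scaled Newton set has `P₀ + P₁ ≥ d! + 1` (indeed `> d!`). -/
theorem factorial_lt_sum_of_isPosT {d : ℕ} {A : Fin d → MvPowerSeries (Fin 2) k} (hA : IsPosT d A) :
    ∀ P ∈ newtonSet A, d.factorial < P 0 + P 1 := by
  rintro P ⟨j, e, he, rfl⟩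
  have hlt : ((d - (j : ℕ) : ℕ) : ℕ∞) < (A j).order := hA j
  have hsum : d - (j : ℕ) < e 0 + e 1 := by
    by_contra hle
    push Not at hle
    apply he
    apply coeff_of_lt_order
    refine lt_of_le_of_lt ?_ hlt
    have hdeg : Finsupp.degree e = e 0 + e 1 := by rw [Finsupp.degree_eq_sum]; simp [Fin.sum_univ_two]
    rw [hdeg]; exact_mod_cast hle
  simp only [Finsupp.smul_apply, smul_eq_mul, ← mul_add]
  calc d.factorial = slotWeight d j * (d - (j : ℕ)) := (slotWeight_mul_sub j).symm
    _ < slotWeight d j * (e 0 + e 1) := Nat.mul_lt_mul_of_pos_left hsum (slotWeight_pos j)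

end PolyDescent

end Summit.ResolutionOfSingularities.ResolutionOfSingularities.Theorems

end
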